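import Summits.BirchSwinnertonDyer.BirchSwinnertonDyer.Theorems.ManinLocalTwoThreeKummerMinimalDictionaryPrelims
import HarnessLib

/-!
# The `K`-rational Kummer/UDC line, analytic engines I: the cube-root dictionary for a `3`-torsion point with COMPLEX ordinate
(route `ManinLocalTwoThree`, crux C3 `ManinPrimeToThreeAtNine` stmt-BirchSwinnertonDyer-22968 — residual RES₃♭, -an g39's `K`-line MEMO-an §82,
node (AN♮)_K `KummerCubeRootCongruenceOfBoundedKOfUDC`; cell bsd-f2-manin, prover seat p2 gen 18; `--supports stmt-BirchSwinnertonDyer-22968`)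

-an g39's `K`-line (HOME/an/g39/UDCKummerLineK-an-g39.lean, to land as `…ManinAdditive.UDCKummerLineK`) runs the UDC argument for the
`K`-RATIONAL point of order `3` `T = (X₀, Y₀)` of the short model `E_{W,c}` — `X₀ ∈ ℚ` (root of `Ψ₃`), `Y₀ ∈ K = ℚ(√d)` — with the tangent slope
`α = (3X₀² + a₄)/(2Y₀) ∈ K` (`tangentSlopeC`) and the tangent-line Kummer series
`Θ_T = (z³y)(z) − Y₀z³ − α((z²x)(z)·z − X₀z³) ∈ ℂ⟦q⟧` (`kummerCubeSeriesC`, the tree's `kummerCubeSeries` with `Y₀, α ∈ ℂ`).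
The ANALYTIC half of (AN♮)_K is p2's (AN2) chain re-run with complex `Y₀, α` and `h ∈ ℂ⟦q⟧`; this file re-runs its first four leaves, all stated
DEF-FREE (the `ManinAdditive` statement file is not in the tree yet): the series is written out with a free slope parameter `α : ℂ`, so that
an's `kummerCubeSeriesC W c X₀ Y₀ z` is the instance `α := tangentSlopeC W c X₀ Y₀` by `rfl`, and the Kummer FUNCTION is written out as
`t_s³·(y_s − Y₀ − α(x_s − X₀))`.

* §1 `slopeC_eq` (S3′ slope, complex): for a lift `u` (`c²℘(u) = X₀`, `c³℘'(u)/2 = Y₀`, `℘'(u) ≠ 0`), `(3X₀² + a₄(E_s))/(2Y₀) = c·(3℘(u)² − g₂/4)/℘'(u)`;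
  `tangentLineScalingC`: `t_s³(y_s − Y₀ − α(x_s − X₀)) = c³·t_s³·ℓ_u(c·E_f)` (p2/an S3′ `tangentLineScaling`, complex ordinate).
* §2 `kummerCubeFunctionC_eq_locKummer`, **`kummerCubeAnalyticDictionaryC`** (an's S1 `kummerCubeAnalyticDictionary`, p721486, complex `Y₀, α`):
  `Σ Θₙ𝕢₁(τ)ⁿ = t_s³(y_s − Y₀ − α(x_s − X₀))(τ)` high in the strip — the inner leaves `taylorAt0_locKummer` / `analyticAt_locKummer` were already
  complex-generic.
* §3 **`exists_hasSum_cubeRoot_C`** ((AN2-a) `exists_hasSum_cubeRoot_kummerCubeSeries`, p727203, for `h ∈ ℂ⟦q⟧`): the formal cube root is the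
  Taylor series of a holomorphic cube root `R` near `q = 0`.
* §4 **`exists_hasSum_const_mul_shortT_mul_sigmaCubeRoot_of_lift_C`** ((AN2-b) for a given lift, the C3 LEAD's
  `exists_hasSum_const_mul_shortT_mul_sigmaCubeRoot_of_lift`, p732527, complex ordinate): `Σ hₙqⁿ = κ₀·t_s·W_{u,e}(c·E_f)`, `κ₀ ≠ 0`.

HONEST FRAMING.  Engines only (re-runs of landed theorems with `ℚ` replaced by `ℂ` in the ordinate/slope/cube root); (AN♮)_K, KLINE, RES₃♭, C3,
Manin's conjecture and BSD are NOT proved here.  No sorry, no new axioms. [folklore]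
-/

set_option autoImplicit false
-- lint-debt: the directory name repeats the summit name (sibling precedent `ManinLocalTwoThreeKummerMinimalDictionaryPrelims.lean`)
set_option linter.dupNamespace false

noncomputable section

open scoped Topology PeriodPair
open Complex Filter PowerSeries
open UpperHalfPlane hiding I
open WeierstrassCurve Literature.NumberTheory.EllipticCurves Literature.NumberTheory.EllipticCurves.ModularForms
open Summit.BirchSwinnertonDyer.Rank1Residual.ManinAdditive.CuspidalKummer
open Summit.BirchSwinnertonDyer.Rank1Residual.ManinAdditive.CuspidalKummerThree
open Summit.BirchSwinnertonDyer.Rank1Residual.ManinAdditive.KummerCubeMonodromy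
open Summit.BirchSwinnertonDyer.BirchSwinnertonDyer.Theorems.ManinLocalTwoThree.KummerCubeAnalytic
open Summit.BirchSwinnertonDyer.BirchSwinnertonDyer.Theorems.ManinLocalTwoThree.KummerCubeSigmaLeaves
open Summit.BirchSwinnertonDyer.BirchSwinnertonDyer.Theorems.ManinLocalTwoThree.KummerCubeRootDictionary

namespace Summit.BirchSwinnertonDyer.BirchSwinnertonDyer.Theorems.ManinLocalTwoThree.KLine

variable {W : WeierstrassCurve ℚ} {N : ℕ} [NeZero N]

/-! ### §1 S3′ with complex ordinate -/

/-- **The short-model tangent slope at `T = P_s(u)` is `c·α_u`** (complex ordinate): with `X₀ = c²℘(u)`, `Y₀ = c³℘'(u)/2 ≠ 0`,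
`a₄(E_s) = −c⁴c₄/48 = −c⁴g₂/4`: `(3X₀² + a₄)/(2Y₀) = c·(3℘(u)² − g₂/4)/℘'(u)`. [folklore] -/
theorem slopeC_eq [W.IsElliptic] (D : ModularParametrizationData W N) (X₀ : ℚ) (Y₀ : ℂ) (a : ℂ)
    (hX : (D.c : ℂ) ^ 2 * ℘[D.L] a = (X₀ : ℂ)) (hY : (D.c : ℂ) ^ 3 * ℘'[D.L] a / 2 = Y₀) (h℘ : ℘'[D.L] a ≠ 0) :
    (3 * (X₀ : ℂ) ^ 2 + ((shortModel W D.c).a₄ : ℂ)) / (2 * Y₀) =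
      (D.c : ℂ) * ((3 * ℘[D.L] a ^ 2 - D.L.g₂ / 4) / ℘'[D.L] a) := by
  have hg₂ : D.L.g₂ = (W.c₄ : ℂ) / 12 := by
    have h := D.isNeronLattice.1
    rw [WeierstrassCurve.baseChange, map_c₄] at h
    simpa using h
  rw [shortModel]
  push_cast
  rw [← hX, ← hY, hg₂]
  by_cases hc : (D.c : ℂ) = 0
  · rw [hc]; simp
  · field_simp
    ring

/-- **S3′ `tangentLineScalingC`** (complex ordinate and slope): `t_s³(y_s − Y₀ − α(x_s − X₀))(τ) = c³·t_s(τ)³·ℓ_u(c·E_f(τ))` for `T = P_s(u)` and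
`α = (3X₀² + a₄)/(2Y₀)`. [folklore] -/
theorem tangentLineScalingC [W.IsElliptic] [W.IsGloballyMinimal] (D : ModularParametrizationData W N) (X₀ : ℚ) (Y₀ α : ℂ) (a : ℂ)
    (hX : (D.c : ℂ) ^ 2 * ℘[D.L] a = (X₀ : ℂ)) (hY : (D.c : ℂ) ^ 3 * ℘'[D.L] a / 2 = Y₀) (h℘ : ℘'[D.L] a ≠ 0)
    (hα : α = (3 * (X₀ : ℂ) ^ 2 + ((shortModel W D.c).a₄ : ℂ)) / (2 * Y₀)) (τ : ℍ) :
    shortT D τ ^ 3 * (shortY D τ - Y₀ - α * (shortX D τ - (X₀ : ℂ))) =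
      (D.c : ℂ) ^ 3 * shortT D τ ^ 3 * tangentLinePullback D.L a ((D.c : ℂ) * eichlerIntegral D.f τ) := by
  rw [hα, slopeC_eq D X₀ Y₀ a hX hY h℘, tangentLinePullback, ← hX, ← hY, shortX, shortY]
  field_simp

/-! ### §2 S1 with complex ordinate and slope -/

/-- Off the lattice `c⁻¹Λ`, `t_s³(y_s − Y₀ − α(x_s − X₀))(τ)` is the Kummer germ `locKummer` of the short model at `E_f(τ)` (complex `α, X₀, Y₀`;
p2's `kummerCubeFunction_eq_locKummer` verbatim otherwise). [folklore] -/
theorem kummerCubeFunctionC_eq_locKummer (D : ModularParametrizationData W N) (hc : (D.c : ℂ) ≠ 0) (α X₀ Y₀ : ℂ) (τ : ℍ)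
    (hτ : eichlerIntegral D.f τ ∉ (D.L.mulLeft ((D.c : ℂ)⁻¹) (inv_ne_zero hc)).lattice) :
    shortT D τ ^ 3 * (shortY D τ - Y₀ - α * (shortX D τ - X₀)) =
      locKummer (D.L.mulLeft ((D.c : ℂ)⁻¹) (inv_ne_zero hc)) ((shortModel W D.c).map (algebraMap ℚ ℂ))
        α X₀ Y₀ (eichlerIntegral D.f τ) := by
  set L' := D.L.mulLeft ((D.c : ℂ)⁻¹) (inv_ne_zero hc) with hL'
  set u := eichlerIntegral D.f τ with hu
  have hP : ℘[L'] u = (D.c : ℂ) ^ 2 * ℘[D.L] ((D.c : ℂ) * u) := by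
    have h := PeriodPair.weierstrassP_mulLeft ((D.c : ℂ)⁻¹) (inv_ne_zero hc) D.L ((D.c : ℂ) * u)
    rw [inv_mul_cancel_left₀ hc, inv_pow, inv_inv] at h
    exact h
  have hP' : ℘'[L'] u = (D.c : ℂ) ^ 3 * ℘'[D.L] ((D.c : ℂ) * u) := by
    have h := PeriodPair.derivWeierstrassP_mulLeft ((D.c : ℂ)⁻¹) (inv_ne_zero hc) D.L ((D.c : ℂ) * u)
    rw [inv_mul_cancel_left₀ hc, inv_pow, inv_inv] at h
    exact h
  have ha₁ : ((shortModel W D.c).map (algebraMap ℚ ℂ)).a₁ = 0 := by simp [shortModel]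
  have ha₃ : ((shortModel W D.c).map (algebraMap ℚ ℂ)).a₃ = 0 := by simp [shortModel]
  have hb₂ : ((shortModel W D.c).map (algebraMap ℚ ℂ)).b₂ = 0 := by
    simp [shortModel, WeierstrassCurve.b₂]
  simp only [shortT, shortX, shortY, locKummer, locG, locT, if_neg hτ, ha₁, ha₃, hb₂,
    zero_div, sub_zero, zero_mul, ← hu, hP, hP']
  by_cases hy : ℘'[D.L] ((D.c : ℂ) * u) = 0
  · rw [hy]; simp
  · field_simp
    ring

/-- **S1 with complex ordinate and slope (`kummerCubeAnalyticDictionaryC`).**  For THE germ `z` and any `X₀ ∈ ℚ`, `Y₀, α ∈ ℂ`: high in the strip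
`Σₙ Θₙ 𝕢₁(τ)ⁿ = t_s³(y_s − Y₀ − α(x_s − X₀))(τ)` where `Θ = (z³y)(z) − Y₀z³ − α((z²x)(z)·z − X₀z³) ∈ ℂ⟦q⟧` (an's `kummerCubeSeriesC` for
`α = tangentSlopeC`). [folklore] -/
theorem kummerCubeAnalyticDictionaryC [W.IsElliptic] [W.IsGloballyMinimal]
    (D : ModularParametrizationData W N) (a : ℕ → ℤ) (ha : ∀ n, (a n : ℂ) = cuspCoeff D.f n) (hc : D.c ≠ 0)
    (X₀ : ℚ) (Y₀ α : ℂ) (z : ℚ⟦X⟧) (hz : IsParamGerm W D.c a z) :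
    ∃ B : ℝ, ∀ τ : ℍ, B < τ.im →
      HasSum (fun n : ℕ ↦ coeff n
          (PowerSeries.map (algebraMap ℚ ℂ) ((shortModel W D.c).formalYMulCube.subst z)
            - Y₀ • PowerSeries.map (algebraMap ℚ ℂ) (z ^ 3)
            - α • PowerSeries.map (algebraMap ℚ ℂ) ((shortModel W D.c).formalXMulSq.subst z * z - X₀ • z ^ 3)) *
          Function.Periodic.qParam 1 (τ : ℂ) ^ n)
        (shortT D τ ^ 3 * (shortY D τ - Y₀ - α * (shortX D τ - (X₀ : ℂ)))) := by
  have hcC : (D.c : ℂ) ≠ 0 := by exact_mod_cast hc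
  set L' := D.L.mulLeft ((D.c : ℂ)⁻¹) (inv_ne_zero hcC) with hL'
  set V := (shortModel W D.c).map (algebraMap ℚ ℂ) with hV
  obtain ⟨h₂, h₃⟩ := isNeron_shortModel W D hcC
  rw [← hL', ← hV] at h₂ h₃
  -- the analytic germ `K = locKummer ∘ ε` in the variable `q`
  set K : ℂ → ℂ := locKummer L' V α (X₀ : ℂ) Y₀ ∘ qGerm D.f with hK
  have hε := analyticAt_qGerm D.f
  have hε0 := qGerm_zero D.f
  have hH := analyticAt_locKummer L' V α (X₀ : ℂ) Y₀
  have hKa : AnalyticAt ℂ K 0 := by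
    have h' : AnalyticAt ℂ (locKummer L' V α (X₀ : ℂ) Y₀) (qGerm D.f 0) := by rw [hε0]; exact hH
    exact h'.comp hε
  obtain ⟨r, hr, hsum⟩ := exists_hasSum_taylorAt0 hKa
  obtain ⟨B, hB⟩ := exists_im_bound W D hcC hr
  -- the Taylor series of `K` is `Θ`
  have hE0 : constantCoeff V.formalExp = 0 := V.constantCoeff_formalExp
  have hsE : HasSubst V.formalExp := HasSubst.of_constantCoeff_zero' hE0
  set zC : PowerSeries ℂ := z.map (algebraMap ℚ ℂ) with hzC
  have hz0 : constantCoeff zC = 0 := by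
    rw [hzC, ← coeff_zero_eq_constantCoeff_apply, coeff_map, coeff_zero_eq_constantCoeff_apply, hz.1,
      map_zero]
  have hsz : HasSubst zC := HasSubst.of_constantCoeff_zero' hz0
  have hszQ : HasSubst z := HasSubst.of_constantCoeff_zero' hz.1
  set ℓ : PowerSeries ℂ := PowerSeries.mk fun n => cuspCoeff D.f n / n with hℓ
  have hlog : V.formalLog.subst zC = ℓ := by
    have h := congrArg (PowerSeries.map (algebraMap ℚ ℂ)) hz.2
    rw [map_subst_univ hszQ, WeierstrassCurve.map_formalLog] at h
    rw [hV, hzC, h, hℓ]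
    ext n
    rw [coeff_map, lSeriesLog, coeff_mk, coeff_mk, ← ha n]
    simp
  have hsL : HasSubst V.formalLog := HasSubst.of_constantCoeff_zero' V.constantCoeff_formalLog
  have hexp : V.formalExp.subst ℓ = zC := by
    rw [← hlog, ← PowerSeries.subst_comp_subst_apply hsL hsz, V.formalExp_subst_formalLog,
      PowerSeries.subst_X hsz]
  set Θ : PowerSeries ℂ := PowerSeries.map (algebraMap ℚ ℂ) ((shortModel W D.c).formalYMulCube.subst z)
      - Y₀ • PowerSeries.map (algebraMap ℚ ℂ) (z ^ 3)
      - α • PowerSeries.map (algebraMap ℚ ℂ) ((shortModel W D.c).formalXMulSq.subst z * z - X₀ • z ^ 3) with hΘ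
  have hT : taylorAt0 K = Θ := by
    rw [hK, taylorAt0_comp hH hε hε0, taylorAt0_locKummer L' V h₂ h₃, taylorAt0_qGerm, ← hℓ,
      PowerSeries.subst_comp_subst_apply hsE (HasSubst.of_constantCoeff_zero' (by
        rw [hℓ, ← coeff_zero_eq_constantCoeff_apply, coeff_mk]; simp)) _, hexp]
    have hsXq : (shortModel W D.c).formalXMulSq.map (algebraMap ℚ ℂ) = V.formalXMulSq := by
      rw [hV, WeierstrassCurve.map_formalXMulSq]
    have hrhs : Θ = -(V.formalXMulSq.subst zC) - C Y₀ * zC ^ 3 -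
          C α * (V.formalXMulSq.subst zC * zC - C (X₀ : ℂ) * zC ^ 3) := by
      rw [hΘ, show (shortModel W D.c).formalYMulCube = -(shortModel W D.c).formalXMulSq from rfl,
        smul_eq_C_mul, smul_eq_C_mul, smul_eq_C_mul]
      simp only [map_sub, map_mul, map_pow, map_neg, PowerSeries.map_C, map_subst_univ hszQ,
        hsXq, ← hzC, eq_ratCast]
      rw [← coe_substAlgHom hsz, map_neg, coe_substAlgHom]
    rw [hrhs, formalKummer, ← coe_substAlgHom hsz]
    simp only [map_sub, map_neg, map_mul, map_pow, substAlgHom_X hsz,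
      Literature.NumberTheory.EllipticCurves.substAlgHom_C hsz, coe_substAlgHom]
  refine ⟨B, fun τ hτ => ?_⟩
  obtain ⟨hτΛ, hτq⟩ := hB τ hτ
  have hS := hsum _ hτq
  have hKq : K (Function.Periodic.qParam 1 (τ : ℂ)) = shortT D τ ^ 3 * (shortY D τ - Y₀ - α * (shortX D τ - (X₀ : ℂ))) := by
    rw [hK, Function.comp_apply, qGerm_apply]
    exact (kummerCubeFunctionC_eq_locKummer D hcC α (X₀ : ℂ) Y₀ τ hτΛ).symm
  rw [hKq, hT] at hS
  exact hS

/-! ### §3 (AN2-a) for a complex cube root -/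

/-- **(AN2-a) for `h ∈ ℂ⟦q⟧` (`exists_hasSum_cubeRoot_C`).**  If `h³ = Θ` (the complex tangent-line Kummer series above) and `h(0) = −1`, there
are `R` analytic at `0` with `R(0) = −1` and `B′` such that for `Im τ > B′`: `Σ hₙ𝕢₁(τ)ⁿ → R(𝕢₁τ)`,
`R(𝕢₁τ)³ = t_s³(y_s − Y₀ − α(x_s − X₀))(τ)`, and `R` is analytic at `𝕢₁τ`. [folklore] -/
theorem exists_hasSum_cubeRoot_C [W.IsElliptic] [W.IsGloballyMinimal]
    (D : ModularParametrizationData W N) (a : ℕ → ℤ) (ha : ∀ n, (a n : ℂ) = cuspCoeff D.f n) (hc0 : D.c ≠ 0)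
    (X₀ : ℚ) (Y₀ α : ℂ) (z : ℚ⟦X⟧) (hz : IsParamGerm W D.c a z) (h : ℂ⟦X⟧)
    (hh3 : h ^ 3 = PowerSeries.map (algebraMap ℚ ℂ) ((shortModel W D.c).formalYMulCube.subst z)
            - Y₀ • PowerSeries.map (algebraMap ℚ ℂ) (z ^ 3)
            - α • PowerSeries.map (algebraMap ℚ ℂ) ((shortModel W D.c).formalXMulSq.subst z * z - X₀ • z ^ 3))
    (hh0 : constantCoeff h = -1) :
    ∃ (R : ℂ → ℂ) (B : ℝ), AnalyticAt ℂ R 0 ∧ R 0 = -1 ∧ ∀ τ : ℍ, B < τ.im →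
      HasSum (fun n : ℕ => coeff n h * Function.Periodic.qParam 1 (τ : ℂ) ^ n) (R (Function.Periodic.qParam 1 (τ : ℂ))) ∧
      R (Function.Periodic.qParam 1 (τ : ℂ)) ^ 3 = shortT D τ ^ 3 * (shortY D τ - Y₀ - α * (shortX D τ - (X₀ : ℂ))) ∧
      AnalyticAt ℂ R (Function.Periodic.qParam 1 (τ : ℂ)) := by
  obtain ⟨B, hB⟩ := kummerCubeAnalyticDictionaryC D a ha hc0 X₀ Y₀ α z hz
  obtain ⟨A, hAan, hTA, B₁, hA⟩ := exists_analyticAt_of_hasSum_qParam hB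
  have hhc3 : h ^ 3 = taylorAt0 A := by rw [hTA, hh3]
  have hA0 : A 0 ≠ 0 := by
    have h1 : constantCoeff h ^ 3 = A 0 := by rw [← map_pow, hhc3, constantCoeff_taylorAt0]
    rw [hh0] at h1
    rw [← h1]; norm_num
  obtain ⟨R, hRan, hR0, hTR, hRk, r, hr, hsum⟩ := exists_analytic_root_of_formal_root hAan hA0 three_ne_zero hhc3
  obtain ⟨ρ, hρ, hRball⟩ := hRan.exists_ball_analyticOnNhd
  have hev : ∀ᶠ q in 𝓝[≠] (0 : ℂ), R q ^ 3 = A q ∧ ‖q‖ < r ∧ q ∈ Metric.ball (0 : ℂ) ρ := by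
    have h1 : ∀ᶠ q in 𝓝 (0 : ℂ), ‖q‖ < r := by
      have : Metric.ball (0 : ℂ) r ∈ 𝓝 (0 : ℂ) := Metric.ball_mem_nhds 0 hr
      filter_upwards [this] with q hq
      rwa [Metric.mem_ball, dist_zero_right] at hq
    have h2 : ∀ᶠ q in 𝓝 (0 : ℂ), q ∈ Metric.ball (0 : ℂ) ρ := Metric.ball_mem_nhds 0 hρ
    exact (((hRk.and h1).and h2).filter_mono nhdsWithin_le_nhds).mono fun q hq => ⟨hq.1.1, hq.1.2, hq.2⟩
  obtain ⟨B₂, hB₂⟩ := exists_im_bound_of_eventually hev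
  refine ⟨R, max B₁ B₂, hRan, by rw [hR0, hh0], fun τ hτ => ?_⟩
  have h1 : B₁ < τ.im := (le_max_left _ _).trans_lt hτ
  have h2 : B₂ < τ.im := (le_max_right _ _).trans_lt hτ
  obtain ⟨hcube, hqr, hqρ⟩ := hB₂ τ h2
  exact ⟨hsum _ hqr, by rw [hcube, hA τ h1], hRball _ hqρ⟩

/-! ### §4 (AN2-b) for a given lift, complex ordinate -/

/-- **(AN2-b) for a given lift `u`, complex ordinate (`exists_hasSum_const_mul_shortT_mul_sigmaCubeRoot_of_lift_C`).**  For a lift `u ∉ Λ`,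
`3u = m₁ω₁ + m₂ω₂`, of `T = (X₀, Y₀)` (`c²℘(u) = X₀`, `c³℘'(u)/2 = Y₀`), THE germ `z`, `α = (3X₀² + a₄)/(2Y₀)` and a complex formal cube root `h`
of `Θ_T` with `h(0) = −1`: `Σ hₙ𝕢₁(τ)ⁿ = κ₀·t_s(τ)·W_{u,e}(c·E_f(τ))` for `Im τ > B`, `κ₀ ≠ 0`, `e = m₁η₁ + m₂η₂` (the C3 LEAD's p732527 re-run).
[folklore] -/
theorem exists_hasSum_const_mul_shortT_mul_sigmaCubeRoot_of_lift_C [W.IsElliptic] [W.IsGloballyMinimal]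
    (D : ModularParametrizationData W N) (a : ℕ → ℤ) (ha : ∀ n, (a n : ℂ) = cuspCoeff D.f n)
    (X₀ : ℚ) (Y₀ α : ℂ) {u : ℂ} (hu : u ∉ D.L.lattice) {m₁ m₂ : ℤ} (hm : 3 * u = m₁ * D.L.ω₁ + m₂ * D.L.ω₂)
    (hX : (D.c : ℂ) ^ 2 * ℘[D.L] u = (X₀ : ℂ)) (hY : (D.c : ℂ) ^ 3 * ℘'[D.L] u / 2 = Y₀)
    (hα : α = (3 * (X₀ : ℂ) ^ 2 + ((shortModel W D.c).a₄ : ℂ)) / (2 * Y₀))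
    (z : ℚ⟦X⟧) (hz : IsParamGerm W D.c a z) (h : ℂ⟦X⟧)
    (hh3 : h ^ 3 = PowerSeries.map (algebraMap ℚ ℂ) ((shortModel W D.c).formalYMulCube.subst z)
            - Y₀ • PowerSeries.map (algebraMap ℚ ℂ) (z ^ 3)
            - α • PowerSeries.map (algebraMap ℚ ℂ) ((shortModel W D.c).formalXMulSq.subst z * z - X₀ • z ^ 3))
    (hh0 : constantCoeff h = -1) :
    ∃ (κ : ℂ) (B : ℝ), κ ≠ 0 ∧ ∀ τ : ℍ, B < τ.im →
      HasSum (fun n : ℕ => coeff n h * Function.Periodic.qParam 1 (τ : ℂ) ^ n)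
        (κ * (shortT D τ * sigmaCubeRoot D.L u (m₁ * D.L.η₁ + m₂ * D.L.η₂) ((D.c : ℂ) * eichlerIntegral D.f τ))) := by
  -- adapted from `MinimalDictionary.exists_hasSum_const_mul_shortT_mul_sigmaCubeRoot_of_lift` (C3 LEAD p1 g16, p732527)
  have hc0 : D.c ≠ 0 := D.maninConstant_ne_zero_holds
  have hc : (D.c : ℂ) ≠ 0 := Int.cast_ne_zero.mpr hc0
  have h3u : 3 * u ∈ D.L.lattice := PeriodPair.mem_lattice.mpr ⟨m₁, m₂, hm.symm⟩
  have h℘'u : ℘'[D.L] u ≠ 0 := by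
    intro h0
    have h2 := D.L.two_mul_mem_lattice_of_derivWeierstrassP_eq_zero hu h0
    apply hu
    have := D.L.lattice.sub_mem h3u h2
    rwa [show (3 : ℂ) * u - 2 * u = u by ring] at this
  set e : ℂ := m₁ * D.L.η₁ + m₂ * D.L.η₂ with he
  obtain ⟨C, hC0, hS3⟩ := sigmaTangentLineIdentity D.L u m₁ m₂ hu hm
  have hS3' := tangentLineScalingC D X₀ Y₀ α u hX hY h℘'u hα
  obtain ⟨Φ, P₃, hΦan, hΦ0, hP₃d, hP₃0, hΦeq⟩ := exists_analytic_shortT_mul_sigmaCubeRoot D hc0 hu e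
  obtain ⟨R, B₁, hRan, hR0, hR⟩ := exists_hasSum_cubeRoot_C D a ha hc0 X₀ Y₀ α z hz h hh3 hh0
  have hf1 : cuspCoeff D.f 1 = 1 := by
    rw [D.isNewformOf.2 1, W.isMultiplicative_LFunction.map_one]; simp
  have hev := eventually_smul_qGerm_notMem D.f hf1 D.L hc hP₃d.continuous.continuousAt (by rw [hP₃0]; norm_num)
  obtain ⟨B₂, hB₂⟩ := exists_im_bound_of_eventually hev
  set K : ℂ := (D.c : ℂ) ^ 3 * C with hK
  set Ψ : ℂ → ℂ := fun q => Φ ((D.c : ℂ) * qGerm D.f q) with hΨ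
  have hΨan : AnalyticAt ℂ Ψ 0 := by
    have hinner : AnalyticAt ℂ (fun q : ℂ => (D.c : ℂ) * qGerm D.f q) 0 :=
      analyticAt_const.mul (analyticAt_qGerm D.f)
    have h0 : (fun q : ℂ => (D.c : ℂ) * qGerm D.f q) 0 = 0 := by simp [qGerm_zero]
    have hcomp : AnalyticAt ℂ (Φ ∘ fun q : ℂ => (D.c : ℂ) * qGerm D.f q) 0 := hΦan.comp_of_eq hinner h0
    rw [hΨ]
    exact hcomp
  have hΨ0 : Ψ 0 = Φ 0 := by simp [hΨ, qGerm_zero]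
  have hΨτ : ∀ τ : ℍ, Ψ (Function.Periodic.qParam 1 (τ : ℂ)) = Φ ((D.c : ℂ) * eichlerIntegral D.f τ) := by
    intro τ; simp [hΨ, qGerm_apply]
  have hcube : ∀ τ : ℍ, max B₁ B₂ < τ.im →
      R (Function.Periodic.qParam 1 (τ : ℂ)) ^ 3 = K * Ψ (Function.Periodic.qParam 1 (τ : ℂ)) ^ 3 := by
    intro τ hτ
    have h1 : B₁ < τ.im := (le_max_left _ _).trans_lt hτ
    have h2 : B₂ < τ.im := (le_max_right _ _).trans_lt hτ
    obtain ⟨hwΛ, hP₃w⟩ := hB₂ τ h2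
    rw [qGerm_apply] at hwΛ hP₃w
    rw [(hR τ h1).2.1, hS3' τ, hS3 _ hwΛ, hΨτ, ← hΦeq τ hwΛ hP₃w, hK]
    ring
  have hev3 : ∀ᶠ q in 𝓝[≠] (0 : ℂ), R q ^ 3 = K * Ψ q ^ 3 := eventually_nhdsWithin_of_forall_im_gt hcube
  have h0 : R 0 ^ 3 = K * Ψ 0 ^ 3 :=
    eq_at_zero_of_eventuallyEq (F := fun q => R q ^ 3) (G := fun q => K * Ψ q ^ 3)
      (hRan.continuousAt.pow 3) (continuousAt_const.mul (hΨan.continuousAt.pow 3)) hev3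
  have hfull : ∀ᶠ q in 𝓝 (0 : ℂ), R q ^ 3 = K * Ψ q ^ 3 := by
    have h' := eventually_nhdsWithin_iff.mp hev3
    filter_upwards [h'] with q hq
    by_cases hq0 : q = 0
    · subst hq0; exact h0
    · exact hq hq0
  have hΨ0ne : Ψ 0 ≠ 0 := by rw [hΨ0]; exact hΦ0
  set κ : ℂ := R 0 / Ψ 0 with hκdef
  have hκ0 : κ ≠ 0 := div_ne_zero (by rw [hR0]; norm_num) hΨ0ne
  have hκ3 : κ ^ 3 = K := by
    rw [hκdef, div_pow, div_eq_iff (pow_ne_zero 3 hΨ0ne)]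
    exact h0
  have hGan : AnalyticAt ℂ (fun q => κ * Ψ q) 0 := analyticAt_const.mul hΨan
  have hT : taylorAt0 (fun q => κ * Ψ q) = taylorAt0 R := by
    have hpow : taylorAt0 (fun q => κ * Ψ q) ^ 3 = taylorAt0 R ^ 3 := by
      rw [← taylorAt0_pow hGan 3, ← taylorAt0_pow hRan 3]
      apply taylorAt0_congr
      filter_upwards [hfull] with q hq
      rw [mul_pow, hκ3, hq]
    have hcc : constantCoeff (taylorAt0 (fun q => κ * Ψ q)) = constantCoeff (taylorAt0 R) := by
      rw [constantCoeff_taylorAt0, constantCoeff_taylorAt0, hκdef, div_mul_cancel₀ _ hΨ0ne]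
    refine eq_of_pow_eq_of_constantCoeff_eq three_ne_zero hpow hcc ?_
    rw [hcc, constantCoeff_taylorAt0, hR0]; norm_num
  have heq := eventuallyEq_of_taylorAt0_eq hGan hRan hT
  obtain ⟨B₃, hB₃⟩ := exists_im_bound_of_eventually (heq.filter_mono nhdsWithin_le_nhds)
  refine ⟨κ, max (max B₁ B₂) B₃, hκ0, fun τ hτ => ?_⟩
  have h12 : max B₁ B₂ < τ.im := (le_max_left _ _).trans_lt hτ
  have h1 : B₁ < τ.im := (le_max_left _ _).trans_lt h12
  have h2 : B₂ < τ.im := (le_max_right _ _).trans_lt h12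
  have h3 : B₃ < τ.im := (le_max_right _ _).trans_lt hτ
  obtain ⟨hwΛ, hP₃w⟩ := hB₂ τ h2
  rw [qGerm_apply] at hwΛ hP₃w
  have hsum := (hR τ h1).1
  rw [← hB₃ τ h3, hΨτ τ, ← hΦeq τ hwΛ hP₃w] at hsum
  exact hsum

end Summit.BirchSwinnertonDyer.BirchSwinnertonDyer.Theorems.ManinLocalTwoThree.KLine

end
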